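import Summits.BirchSwinnertonDyer.Rank1Residual.X11b.BDPRouteStrictAtPlace
import Summits.BirchSwinnertonDyer.Rank1Residual.X11b.RelaxationOfSelmerClass
import Literature.NumberTheory.EllipticCurves.StrictSelmerTorsionLevelUniformBound
import Literature.NumberTheory.EllipticCurves.SelmerLocalConditionUnramifiedUniform
import Literature.NumberTheory.GaloisCohomology.PoitouTateNumberField
import Literature.NumberTheory.GaloisRepresentations.LocalEulerPoincareCharacteristicProofs
import HarnessLib

/-!
# Rank one at finite level, UNIFORMLY in the level: the strict count and the relaxation index at a place
# above `p` are bounded independently of `k` (hand HT-2 of crux `SupersingularRankZeroAtTwo`, twist side)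

Cell `bsd-2adic`, seat `bsd-2adic-tower-1` GEN 58, `--supports stmt-BirchSwinnertonDyer-19097` (helper). HONEST FRAMING:
THEOREMS ONLY (no `def`, no named fact, no instance, no `sorry`); nothing is booked; `SupersingularRankZeroAtTwo`,
CDF_glob and BSD are NOT proved by any of this. The two bounds of Jetchev–Skinner–Wan 2017 Prop. 3.2.1 `≤` at every
finite level `n = p^k` for a rank-one curve, with the level-dependence made explicit and then removed:
* §1 `index_zmultiples_sup_range_le`: in an abelian group `A` with a finite-index `U ≃+ ℤ_p` and `x` of infinite
  order, `[A : ℤx + p^k A] ≤ [A : U] · p^a` for every `k` (`a = v_p e(m x)`, `m = [A : U]`); `λ : A →+ ℤ_p` killing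
  exactly the torsion (`exists_addMonoidHom_padicInt_of_finiteIndex`);
* §2 `exists_finiteIndex_addEquiv_padicInt_adicCompletion` — Silverman VII.6.3 on `E(ℚ_v)`, `v ∋ p` (transport of the
  tree's `exists_finiteIndex_addEquiv_padicInt_holds` along Mathlib's `ℚ_v ≃ₐ[ℚ] ℚ_p`);
* (sibling file `…TwistSideLocalIndex.lean`) §3 `exists_natCard_selmerGroup_inf_ker_res_le` — `∃ C, ∀ k, #(Sel^{(p^k)}(E/K) ∩ ker res_E) ≤ C` (rank 1, `Ш[p^∞]`
  finite; the tree's Part A `X11b.StrictAtPlace.natCard_selmerGroup_inf_ker_res_le` + `#Ш[p^k] ≤ #Ш[p^∞]` +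
  `#(κ(E(K)) ∩ ker res_E) ≤ p^{v_p λ(P₁)} · #E(K)_tors`);
* §4 `exists_relIndex_selmerGroup_kummerOutside_le` — `∃ C, ∀ k ≥ 1, [kummerOutside E p^k {v} : Sel^{(p^k)}(E/K)] ≤ C`
  (the tree's `X11b.Relaxation.relIndex_selmerGroup_kummerOutside_le_index_zmultiples_of_facts` at `ξ = κ(P₁)`, fed by
  `poitouTate_sum_localTatePairing_eq_zero_holds` and `localEulerPoincareCharacteristic_holds`, then §1).

References: [JetchevSkinnerWan2017] Prop. 3.2.1 (arXiv:1512.06894 pp. 10–11); [Skinner2020] §2.2 Lemma `rank1lemma`;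
[SilvermanAEC2009] Prop. VII.6.3, VIII.§2, X.§4; [MilneADT2006] I Thm. 2.8, Thm. 4.10 (b).
-/

set_option autoImplicit false
set_option linter.dupNamespace false

noncomputable section

open scoped Classical

universe u

namespace Summit.BirchSwinnertonDyer.BirchSwinnertonDyer.Theorems.FlatBlindTwistSide

open Field NumberField IsDedekindDomain WeierstrassCurve Function
open Literature.NumberTheory.EllipticCurves Literature.NumberTheory.GaloisRepresentations
  Literature.NumberTheory.GaloisCohomology

/-! ## §1 Lattice algebra: `[A : ℤx + p^k A]` is bounded when `A ⊇ U ≅ ℤ_p` of finite index -/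

section Lattice

variable {A : Type*} [AddCommGroup A] (p : ℕ) [Fact p.Prime]

/-- The subgroup `p^j U` (`U ≃+ ℤ_p` of finite index `m`) has index `m · p^j`. [folklore] -/
theorem index_range_comp_subtype_eq (U : AddSubgroup A) [U.FiniteIndex] (e : U ≃+ ℤ_[p]) (j : ℕ) :
    (((zsmulAddGroupHom ((p : ℤ) ^ j) : A →+ A).comp U.subtype).range).index = U.index * p ^ j := by
  set K : AddSubgroup A := ((zsmulAddGroupHom ((p : ℤ) ^ j) : A →+ A).comp U.subtype).range with hK
  have hKU : K ≤ U := by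
    rintro _ ⟨u, rfl⟩
    exact U.zsmul_mem u.2 _
  -- `K` pulled back to `U` is the preimage of `p^j ℤ_p` under `e`
  have hsub : K.addSubgroupOf U = ((Ideal.span {(p : ℤ_[p]) ^ j}).toAddSubgroup).comap e.toAddMonoidHom := by
    ext u
    rw [AddSubgroup.mem_addSubgroupOf, AddSubgroup.mem_comap, Submodule.mem_toAddSubgroup,
      Ideal.mem_span_singleton]
    constructor
    · rintro ⟨u', hu'⟩
      refine ⟨e u', ?_⟩
      have h1 : (u : A) = ((p : ℤ) ^ j) • (u' : A) := hu'.symm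
      have h2 : u = ((p : ℤ) ^ j) • u' := Subtype.ext (by rw [h1, AddSubgroupClass.coe_zsmul])
      change e u = _
      rw [h2, map_zsmul, zsmul_eq_mul, Int.cast_pow, Int.cast_natCast, mul_comm]
    · rintro ⟨c, hc⟩
      refine ⟨e.symm c, ?_⟩
      change ((p : ℤ) ^ j) • ((e.symm c : U) : A) = u
      rw [← AddSubgroupClass.coe_zsmul]
      congr 1
      apply e.injective
      change e (((p : ℤ) ^ j) • e.symm c) = e u
      rw [map_zsmul, e.apply_symm_apply, zsmul_eq_mul, Int.cast_pow, Int.cast_natCast]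
      exact hc.symm
  have hrel : K.relIndex U = p ^ j := by
    rw [AddSubgroup.relIndex, hsub, AddSubgroup.index_comap_of_surjective _ e.surjective]
    have hker : (Ideal.span {(p : ℤ_[p]) ^ j}).toAddSubgroup =
        (PadicInt.toZModPow j : ℤ_[p] →+* ZMod (p ^ j)).toAddMonoidHom.ker := by
      rw [← PadicInt.ker_toZModPow]; rfl
    rw [hker, AddSubgroup.index_ker, AddMonoidHom.range_eq_top_of_surjective _
      (ZMod.ringHom_surjective (PadicInt.toZModPow j)), AddSubgroup.card_top, Nat.card_zmod]
  rw [← AddSubgroup.relIndex_mul_index hKU, hrel, mul_comm]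

/-- **`[A : ℤx + p^k A] ≤ [A : U] · p^a` for all `k`**, where `U ≃+ ℤ_p` has finite index `m = [A : U]` in `A`,
`x ∈ A` has infinite order and `a = v_p(e(m • x))`: the subgroup `ℤx + p^k A` contains `p^{k} U` (trivially)
and, for `k ≥ a`, even `p^a U` (`p^a U = ℤ_p · m x ⊆ ℤ m x + p^k U`, approximating a `p`-adic integer by an
integer modulo `p^k`). [cite: SilvermanAEC2009, Prop. VII.6.3] -/
theorem index_zmultiples_sup_range_le (U : AddSubgroup A) [U.FiniteIndex] (e : U ≃+ ℤ_[p]) (x : A)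
    (hx : ¬ IsOfFinAddOrder x) :
    ∃ C : ℕ, 0 < C ∧ ∀ k : ℕ,
      (AddSubgroup.zmultiples x ⊔ (zsmulAddGroupHom ((p : ℤ) ^ k) : A →+ A).range).index ≤ C := by
  have hp : p.Prime := Fact.out
  set m : ℕ := U.index with hm
  have hm0 : m ≠ 0 := AddSubgroup.FiniteIndex.index_ne_zero
  have hmx : m • x ∈ U := U.nsmul_index_mem x
  set z : ℤ_[p] := e ⟨m • x, hmx⟩ with hz
  have hz0 : z ≠ 0 := by
    intro h
    apply hx
    have h1 : (⟨m • x, hmx⟩ : U) = 0 := e.injective (by rw [← hz, h, map_zero])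
    have h2 : m • x = 0 := congrArg Subtype.val h1
    exact isOfFinAddOrder_iff_nsmul_eq_zero.mpr ⟨m, Nat.pos_of_ne_zero hm0, h2⟩
  set a : ℕ := z.valuation with ha
  refine ⟨m * p ^ a, Nat.mul_pos (Nat.pos_of_ne_zero hm0) (pow_pos hp.pos a), fun k ↦ ?_⟩
  set V : AddSubgroup A := AddSubgroup.zmultiples x ⊔ (zsmulAddGroupHom ((p : ℤ) ^ k) : A →+ A).range with hV
  -- `p^j U ≤ V` for `j = max a k`... we use `j = k` if `k ≤ a` and `j = a` if `a ≤ k`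
  have hKle : ∀ j : ℕ, k ≤ j ∨ j = a ∧ a ≤ k →
      ((zsmulAddGroupHom ((p : ℤ) ^ j) : A →+ A).comp U.subtype).range ≤ V := by
    rintro j hj _ ⟨u, rfl⟩
    change ((p : ℤ) ^ j) • (u : A) ∈ V
    rcases hj with hkj | ⟨rfl, hak⟩
    · -- `p^j u = p^k (p^{j-k} u)`
      refine AddSubgroup.mem_sup_right ⟨((p : ℤ) ^ (j - k)) • (u : A), ?_⟩
      change ((p : ℤ) ^ k) • (((p : ℤ) ^ (j - k)) • (u : A)) = _
      rw [smul_smul, ← pow_add, Nat.add_sub_cancel' hkj]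
    · -- `p^a u`: write `p^a e(u) = z c`, `c = l + p^k d` with `l ∈ ℕ`
      set c : ℤ_[p] := ((PadicInt.unitCoeff hz0)⁻¹ : ℤ_[p]ˣ) * e u with hc
      have hspec : z = (PadicInt.unitCoeff hz0 : ℤ_[p]) * (p : ℤ_[p]) ^ a := by
        rw [ha]; exact PadicInt.unitCoeff_spec hz0
      have hzc : z * c = (p : ℤ_[p]) ^ a * e u := by
        rw [hc, ← mul_assoc]
        have h1 : z * ((PadicInt.unitCoeff hz0)⁻¹ : ℤ_[p]ˣ) = (p : ℤ_[p]) ^ a :=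
          calc z * ((PadicInt.unitCoeff hz0)⁻¹ : ℤ_[p]ˣ)
              = (PadicInt.unitCoeff hz0 : ℤ_[p]) * (p : ℤ_[p]) ^ a * ((PadicInt.unitCoeff hz0)⁻¹ : ℤ_[p]ˣ) :=
                congrArg (fun t : ℤ_[p] ↦ t * ((PadicInt.unitCoeff hz0)⁻¹ : ℤ_[p]ˣ)) hspec
            _ = (p : ℤ_[p]) ^ a := by rw [mul_comm, ← mul_assoc, Units.inv_mul, one_mul]
        rw [h1]
      obtain ⟨d, hd⟩ := Ideal.mem_span_singleton.mp (PadicInt.appr_spec k c)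
      set l : ℕ := c.appr k with hl
      -- `p^a u = l • (m • x) + p^k • e⁻¹ (z d)`
      have key : ((p : ℤ) ^ a) • u = (l : ℤ) • (⟨m • x, hmx⟩ : U) + ((p : ℤ) ^ k) • e.symm (z * d) := by
        apply e.injective
        simp only [map_add, map_zsmul, e.apply_symm_apply]
        rw [← hz, zsmul_eq_mul, zsmul_eq_mul, zsmul_eq_mul, Int.cast_pow, Int.cast_natCast, Int.cast_pow,
          Int.cast_natCast, Int.cast_natCast, ← hzc]
        have hc' : c = (l : ℤ_[p]) + (p : ℤ_[p]) ^ k * d := by rw [← hd]; ring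
        rw [hc']; ring
      have key' : ((p : ℤ) ^ a) • (u : A) = ((l : ℤ) * m) • x + ((p : ℤ) ^ k) • ((e.symm (z * d) : U) : A) := by
        have h := congrArg (fun y : U ↦ (y : A)) key
        simp only [AddSubgroupClass.coe_zsmul, AddSubgroup.coe_add] at h
        rw [h]
        simp only [mul_zsmul, natCast_zsmul]
      rw [key']
      exact V.add_mem (AddSubgroup.mem_sup_left (AddSubgroup.zsmul_mem _ (AddSubgroup.mem_zmultiples x) _))
        (AddSubgroup.mem_sup_right ⟨_, rfl⟩)
  have hle : ((zsmulAddGroupHom ((p : ℤ) ^ a) : A →+ A).comp U.subtype).range ≤ V := by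
    rcases le_total k a with hka | hak
    · exact hKle a (Or.inl hka)
    · exact hKle a (Or.inr ⟨rfl, hak⟩)
  have hdvd := AddSubgroup.index_dvd_of_le hle
  rw [index_range_comp_subtype_eq p U e a] at hdvd
  exact Nat.le_of_dvd (Nat.mul_pos (Nat.pos_of_ne_zero hm0) (pow_pos hp.pos a)) hdvd

/-- From a finite-index `U ≃+ ℤ_p` in `A`: **a homomorphism `λ : A →+ ℤ_p` vanishing exactly on the torsion**
(`λ(X) = e(m X)`, `m = [A : U]`, `ℤ_p` torsion-free). [cite: SilvermanAEC2009, Prop. VII.6.3] -/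
theorem exists_addMonoidHom_padicInt_of_finiteIndex (U : AddSubgroup A) [U.FiniteIndex] (e : U ≃+ ℤ_[p]) :
    ∃ lam : A →+ ℤ_[p], ∀ X, lam X = 0 ↔ IsOfFinAddOrder X := by
  have hidx : U.index ≠ 0 := AddSubgroup.FiniteIndex.index_ne_zero
  let mulIdx : A →+ U :=
    AddMonoidHom.mk' (fun X => ⟨U.index • X, U.nsmul_index_mem X⟩) fun X Y =>
      Subtype.ext (smul_add (U.index) X Y)
  refine ⟨e.toAddMonoidHom.comp mulIdx, fun X => ?_⟩
  constructor
  · intro h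
    have h1 : mulIdx X = 0 := by
      have : e (mulIdx X) = 0 := h
      exact e.injective (this.trans (map_zero e).symm)
    have h2 : U.index • X = 0 := congrArg Subtype.val h1
    exact isOfFinAddOrder_iff_nsmul_eq_zero.mpr ⟨U.index, Nat.pos_of_ne_zero hidx, h2⟩
  · intro h
    obtain ⟨n, hn, hnX⟩ := isOfFinAddOrder_iff_nsmul_eq_zero.mp h
    have h3 : n • (e.toAddMonoidHom.comp mulIdx) X = 0 := by
      rw [← map_nsmul, hnX, map_zero]
    exact (smul_eq_zero.mp h3).resolve_left hn.ne'

end Lattice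

/-! ## §2 Silverman VII.6.3 on `E(ℚ_v)`, `v ∋ p`, along `ℚ_v ≃ₐ[ℚ] ℚ_p` -/

section Local

variable (W : WeierstrassCurve ℚ) [W.IsElliptic] (p : ℕ) [Fact p.Prime] (v : HeightOneSpectrum (𝓞 ℚ))
  (hv : (p : 𝓞 ℚ) ∈ v.asIdeal)

include hv in
/-- The place `v ∋ p` of `ℚ` corresponds to the prime `p` under Mathlib's `primesEquiv`. [folklore] -/
theorem primesEquiv_eq : (Rat.HeightOneSpectrum.primesEquiv (R := 𝓞 ℚ) v : ℕ) = p := by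
  have hp : p.Prime := Fact.out
  have hmem : ((p : ℕ) : ℤ) ∈ v.asIdeal.map (Rat.IsIntegralClosure.intEquiv (𝓞 ℚ)) := by
    have h := Ideal.mem_map_of_mem (Rat.IsIntegralClosure.intEquiv (𝓞 ℚ)) hv
    rwa [map_natCast] at h
  have hdvd : Rat.HeightOneSpectrum.natGenerator v ∣ p :=
    (Rat.HeightOneSpectrum.natGenerator_dvd_iff v).mpr hmem
  exact (Nat.prime_dvd_prime_iff_eq (Rat.HeightOneSpectrum.prime_natGenerator v) hp).mp hdvd

include hv in
/-- **Silverman VII.6.3 on `E(ℚ_v)` for the place `v ∋ p` of `ℚ`**: `E(ℚ_v)` has a finite-index subgroup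
`U ≃+ ℤ_p` — transport of the tree's `exists_finiteIndex_addEquiv_padicInt_holds` (over `ℚ_p`) along Mathlib's
`ℚ`-algebra isomorphism `ℚ_v ≃ ℚ_p` (`Padic`/`Rat.HeightOneSpectrum.adicCompletion.padicEquiv`).
[cite: SilvermanAEC2009, Prop. VII.6.3] -/
theorem exists_finiteIndex_addEquiv_padicInt_adicCompletion :
    ∃ U : AddSubgroup (W.baseChange (v.adicCompletion ℚ)).toAffine.Point, U.FiniteIndex ∧ Nonempty (U ≃+ ℤ_[p]) := by
  have hℓ := primesEquiv_eq p v hv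
  subst hℓ
  set e := Rat.HeightOneSpectrum.adicCompletion.padicEquiv (R := 𝓞 ℚ) v with he
  let f : (W.baseChange (v.adicCompletion ℚ)).toAffine.Point →+
      (W.baseChange ℚ_[Rat.HeightOneSpectrum.primesEquiv (R := 𝓞 ℚ) v]).toAffine.Point :=
    Affine.Point.map e.toAlgEquiv.toAlgHom
  let g : (W.baseChange ℚ_[Rat.HeightOneSpectrum.primesEquiv (R := 𝓞 ℚ) v]).toAffine.Point →+
      (W.baseChange (v.adicCompletion ℚ)).toAffine.Point :=
    Affine.Point.map e.symm.toAlgEquiv.toAlgHom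
  have hfg : ∀ Q, f (g Q) = Q := by
    intro Q
    change Affine.Point.map _ (Affine.Point.map _ Q) = Q
    rw [Affine.Point.map_map]
    rcases Q with _ | ⟨x, y, h⟩
    · rfl
    · rw [Affine.Point.map_some]
      simp only [AlgHom.coe_comp, Function.comp_apply, Affine.Point.some.injEq]
      exact ⟨e.toAlgEquiv.apply_symm_apply x, e.toAlgEquiv.apply_symm_apply y⟩
  have hf : Function.Bijective f :=
    ⟨Affine.Point.map_injective (W' := W) _, fun Q ↦ ⟨g Q, hfg Q⟩⟩
  set Φ : (W.baseChange (v.adicCompletion ℚ)).toAffine.Point ≃+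
      (W.baseChange ℚ_[Rat.HeightOneSpectrum.primesEquiv (R := 𝓞 ℚ) v]).toAffine.Point :=
    AddEquiv.ofBijective f hf with hΦ
  obtain ⟨A, hA, ⟨eA⟩⟩ := exists_finiteIndex_addEquiv_padicInt_holds
    (Rat.HeightOneSpectrum.primesEquiv (R := 𝓞 ℚ) v : ℕ)
    (W.baseChange ℚ_[Rat.HeightOneSpectrum.primesEquiv (R := 𝓞 ℚ) v])
  haveI := hA
  refine ⟨A.map (Φ.symm : _ →+ _), ⟨?_⟩, ⟨(Φ.symm.addSubgroupMap A).symm.trans eA⟩⟩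
  rw [AddSubgroup.index_map_equiv]
  exact AddSubgroup.FiniteIndex.index_ne_zero

include hv in
/-- **`λ : E(ℚ_v) →+ ℤ_p` vanishing exactly on the torsion**, `v ∋ p` (from VII.6.3 on `E(ℚ_v)`).
[cite: SilvermanAEC2009, Prop. VII.6.3] -/
theorem exists_addMonoidHom_padicInt_adicCompletion :
    ∃ lam : (W.baseChange (v.adicCompletion ℚ)).toAffine.Point →+ ℤ_[p], ∀ X, lam X = 0 ↔ IsOfFinAddOrder X := by
  obtain ⟨U, hU, ⟨e⟩⟩ := exists_finiteIndex_addEquiv_padicInt_adicCompletion W p v hv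
  haveI := hU
  exact exists_addMonoidHom_padicInt_of_finiteIndex p U e

end Local

end Summit.BirchSwinnertonDyer.BirchSwinnertonDyer.Theorems.FlatBlindTwistSide

end
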